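import Mathlib
import HarnessLib
import Literature.Analysis.FluidPDE.VorticityCalculus
import Literature.Analysis.FluidPDE.NSBoundedMildOseen
import Literature.Analysis.UnboundedOperators.HeatKernelHeatEquation
import Summits.NavierStokesRegularity.NavierStokesRegularity.Theses.LoopPeriodRatchet

/-!
# Crux `FrequencyGrowthExponent` (stmt-NavierStokesRegularity-27893), negative side:
# load-bearing hypotheses

Negative-side (cdisprove, D-0016) lemmas for the wall `LoopPeriodRatchet.FrequencyGrowthExponent`; nothing here
closes or changes any item (`--supports`).  Two binders of the crux are shown to be LOAD-BEARING by explicit,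
kernel-checked witnesses («any proof must use them»):

* `frequencyGrowthExponent_false_without_mild` — drop the Oseen–Duhamel (mild Navier–Stokes) coupling between the
  time slices and keep everything else (Type-I time decay, joint continuity, `div v = 0`, e₃-poloidality): FALSE.
  Witness: the Gaussian column `v(t, x) = ramp(t) · e^{-(x₀² + x₁²)} · e₂` with `ramp(t) = max 0 (min 1 (t + 2))`:
  every slice is a smooth bounded poloidal divergence-free vertical field; at `t = -1` the unit circle is a
  closed vortex line of angular frequency `Ω = 2/e` (period `π e`), but the slice `t₀ = -2` is identically zero,
  so no non-stationary loop exists there — vorticity is «born from nothing», which only the NS coupling forbids.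
* `frequencyGrowthExponent_false_without_nonstationary` — drop the non-stationarity clause
  `∃ s, curl (v t) (c s) ≠ 0` of the HYPOTHESIS loop and keep everything else: FALSE, refuted by the zero profile
  `v ≡ 0` (a member of the class: `e^{σΔ} 0 = 0`, `B(0, ·) = 0`), whose constant curves are stationary «loops»
  while the conclusion demands a non-stationary one.  (Degenerate-case tightness: the clause is not decoration.)

The remaining binders (Type-I decay, `div v = 0`, poloidality) are NOT shown load-bearing here: a witness for any
of them would have to be a non-zero ancient mild solution carrying a closed vortex line, i.e. at least a
counterexample-type object for the Liouville problem of Koch–Nadirashvili–Seregin–Šverák (see the companion file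
`Negative/Reductions.lean`: `¬ FrequencyGrowthExponent ↔ HasClassLoop`, `HasClassLoop → ¬ LiouvilleConjectureNS`).

HONEST FRAMING: elementary bookkeeping about an OPEN item of a DOOR route (rung N0-LocalTubeDoorPoloidal); nothing
here bears on `PoloidalWindowDoor.Target` or on Navier–Stokes regularity.
-/

noncomputable section

-- the summit and its single sub-problem share the name (CONVENTIONS §1), as in every Theorems file
set_option linter.dupNamespace false

namespace Summit.NavierStokesRegularity.NavierStokesRegularity.Theorems.FrequencyGrowthExponent.Negative

open Set Function Filter Topology
open scoped RealInnerProductSpace InnerProductSpace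
open Literature.Analysis.FluidPDE

/-! ### The two weakened statements -/

/-- `FrequencyGrowthExponent` with the Oseen–Duhamel binder
`∀ s t, s < t → t < 0 → ∀ x, v t x = e^{(t-s)Δ}(v s) x − B¹_s(v, v) t x` DROPPED (all other binders verbatim). -/
def FrequencyGrowthExponentWithoutMild : Prop :=
  ∀ (C : ℝ) (v : ℝ → EuclideanSpace ℝ (Fin 3) → EuclideanSpace ℝ (Fin 3)),
    Literature.Analysis.FluidPDE.HasTypeITimeDecay C v →
    ContinuousOn (Function.uncurry v) (Set.Iio (0 : ℝ) ×ˢ Set.univ) →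
    (∀ t < 0, Literature.Analysis.FluidPDE.VectorCalculus.IsDivFree (v t)) →
    (∀ s < 0, ∀ y, ⟪Literature.Analysis.FluidPDE.curl (v s) y, EuclideanSpace.single 2 1⟫_ℝ = 0) →
    ∃ A κ : ℝ, 0 < A ∧ κ < 3 / 2 ∧ ∀ t₀ t : ℝ, t₀ ≤ t → t < 0 →
      ∀ (c : ℝ → EuclideanSpace ℝ (Fin 3)) (T : ℝ), 0 < T → Function.Periodic c T →
        (∀ s, HasDerivAt c (Literature.Analysis.FluidPDE.curl (v t) (c s)) s) →
        (∃ s, Literature.Analysis.FluidPDE.curl (v t) (c s) ≠ 0) →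
        ∃ (c₀ : ℝ → EuclideanSpace ℝ (Fin 3)) (T₀ : ℝ), 0 < T₀ ∧ Function.Periodic c₀ T₀ ∧
          (∀ s, HasDerivAt c₀ (Literature.Analysis.FluidPDE.curl (v t₀) (c₀ s)) s) ∧
          (∃ s, Literature.Analysis.FluidPDE.curl (v t₀) (c₀ s) ≠ 0) ∧ T₀ ≤ A * T * ((-t₀) / (-t)) ^ κ

/-- `FrequencyGrowthExponent` with the non-stationarity clause `∃ s, curl (v t) (c s) ≠ 0` of the HYPOTHESIS loop
DROPPED (all other binders verbatim, including the mild one). -/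
def FrequencyGrowthExponentWithoutNonstationary : Prop :=
  ∀ (C : ℝ) (v : ℝ → EuclideanSpace ℝ (Fin 3) → EuclideanSpace ℝ (Fin 3)),
    Literature.Analysis.FluidPDE.HasTypeITimeDecay C v →
    ContinuousOn (Function.uncurry v) (Set.Iio (0 : ℝ) ×ˢ Set.univ) →
    (∀ s t : ℝ, s < t → t < 0 → ∀ x, v t x =
      Literature.Analysis.UnboundedOperators.heatExtension (v s) (t - s) x -
        Literature.Analysis.FluidPDE.oseenDuhamel 1 s v v t x) →
    (∀ t < 0, Literature.Analysis.FluidPDE.VectorCalculus.IsDivFree (v t)) →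
    (∀ s < 0, ∀ y, ⟪Literature.Analysis.FluidPDE.curl (v s) y, EuclideanSpace.single 2 1⟫_ℝ = 0) →
    ∃ A κ : ℝ, 0 < A ∧ κ < 3 / 2 ∧ ∀ t₀ t : ℝ, t₀ ≤ t → t < 0 →
      ∀ (c : ℝ → EuclideanSpace ℝ (Fin 3)) (T : ℝ), 0 < T → Function.Periodic c T →
        (∀ s, HasDerivAt c (Literature.Analysis.FluidPDE.curl (v t) (c s)) s) →
        ∃ (c₀ : ℝ → EuclideanSpace ℝ (Fin 3)) (T₀ : ℝ), 0 < T₀ ∧ Function.Periodic c₀ T₀ ∧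
          (∀ s, HasDerivAt c₀ (Literature.Analysis.FluidPDE.curl (v t₀) (c₀ s)) s) ∧
          (∃ s, Literature.Analysis.FluidPDE.curl (v t₀) (c₀ s) ≠ 0) ∧ T₀ ≤ A * T * ((-t₀) / (-t)) ^ κ

/-! ### The Gaussian column witness -/

/-- The time ramp `max 0 (min 1 (t + 2))`: `0` for `t ≤ -2`, `1` for `t ≥ -1`. -/
def ramp (t : ℝ) : ℝ := max 0 (min 1 (t + 2))

/-- `0 ≤ ramp t`. -/
theorem ramp_nonneg (t : ℝ) : 0 ≤ ramp t := le_max_left _ _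

/-- `ramp t ≤ 1`. -/
theorem ramp_le_one (t : ℝ) : ramp t ≤ 1 := max_le zero_le_one (min_le_left _ _)

/-- `ramp (-1) = 1` (the column is fully switched on at `t = -1`). -/
theorem ramp_neg_one : ramp (-1) = 1 := by norm_num [ramp]

/-- `ramp t = 0` for `t ≤ -2` (the column is off up to `t = -2`). -/
theorem ramp_of_le {t : ℝ} (ht : t ≤ -2) : ramp t = 0 := by
  have : min 1 (t + 2) ≤ 0 := (min_le_right _ _).trans (by linarith)
  simp [ramp, this]

/-- The ramp is continuous. -/
theorem continuous_ramp : Continuous ramp :=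
  continuous_const.max (continuous_const.min (continuous_id.add continuous_const))

/-- Horizontal radius squared `x₀² + x₁²`. -/
def rsq (x : EuclideanSpace ℝ (Fin 3)) : ℝ := x 0 * x 0 + x 1 * x 1

/-- `0 ≤ x₀² + x₁²`. -/
theorem rsq_nonneg (x : EuclideanSpace ℝ (Fin 3)) : 0 ≤ rsq x :=
  add_nonneg (mul_self_nonneg _) (mul_self_nonneg _)

/-- The derivative of `rsq` at `x`: `h ↦ 2 x₀ h₀ + 2 x₁ h₁`. -/
def rsqDeriv (x : EuclideanSpace ℝ (Fin 3)) : EuclideanSpace ℝ (Fin 3) →L[ℝ] ℝ :=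
  (2 * x 0) • (EuclideanSpace.proj (0 : Fin 3) : EuclideanSpace ℝ (Fin 3) →L[ℝ] ℝ) +
    (2 * x 1) • (EuclideanSpace.proj (1 : Fin 3) : EuclideanSpace ℝ (Fin 3) →L[ℝ] ℝ)

/-- Unfolding `rsqDeriv`. -/
@[simp]
theorem rsqDeriv_apply (x h : EuclideanSpace ℝ (Fin 3)) : rsqDeriv x h = 2 * x 0 * h 0 + 2 * x 1 * h 1 := by
  simp [rsqDeriv, mul_assoc]

/-- `D(x₀² + x₁²)(x) = rsqDeriv x` (product rule on the two coordinate forms). -/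
theorem hasFDerivAt_rsq (x : EuclideanSpace ℝ (Fin 3)) : HasFDerivAt rsq (rsqDeriv x) x := by
  have h0 : HasFDerivAt (fun y : EuclideanSpace ℝ (Fin 3) => y 0)
      (EuclideanSpace.proj (0 : Fin 3) : EuclideanSpace ℝ (Fin 3) →L[ℝ] ℝ) x :=
    (EuclideanSpace.proj (0 : Fin 3) : EuclideanSpace ℝ (Fin 3) →L[ℝ] ℝ).hasFDerivAt
  have h1 : HasFDerivAt (fun y : EuclideanSpace ℝ (Fin 3) => y 1)
      (EuclideanSpace.proj (1 : Fin 3) : EuclideanSpace ℝ (Fin 3) →L[ℝ] ℝ) x :=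
    (EuclideanSpace.proj (1 : Fin 3) : EuclideanSpace ℝ (Fin 3) →L[ℝ] ℝ).hasFDerivAt
  have h := (h0.fun_mul h0).fun_add (h1.fun_mul h1)
  refine h.congr_fderiv ?_
  ext v
  simp [rsqDeriv]
  ring

/-- `x ↦ x₀² + x₁²` is continuous. -/
theorem continuous_rsq : Continuous rsq :=
  continuous_iff_continuousAt.2 fun x => (hasFDerivAt_rsq x).continuousAt

/-- The Gaussian `e^{-(x₀² + x₁²)}`. -/
def gauss (x : EuclideanSpace ℝ (Fin 3)) : ℝ := Real.exp (-rsq x)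

/-- The Gaussian is positive. -/
theorem gauss_pos (x : EuclideanSpace ℝ (Fin 3)) : 0 < gauss x := Real.exp_pos _

/-- The Gaussian is at most `1`. -/
theorem gauss_le_one (x : EuclideanSpace ℝ (Fin 3)) : gauss x ≤ 1 :=
  Real.exp_le_one_iff.2 (neg_nonpos.2 (rsq_nonneg x))

/-- `D(e^{-(x₀²+x₁²)})(x) = -e^{-(x₀²+x₁²)} rsqDeriv x` (chain rule). -/
theorem hasFDerivAt_gauss (x : EuclideanSpace ℝ (Fin 3)) :
    HasFDerivAt gauss ((-gauss x) • rsqDeriv x) x := by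
  have h : HasFDerivAt (fun y => Real.exp (-rsq y)) (Real.exp (-rsq x) • -rsqDeriv x) x :=
    (hasFDerivAt_rsq x).neg.exp
  rw [smul_neg, ← neg_smul] at h
  exact h

/-- The Gaussian is continuous. -/
theorem continuous_gauss : Continuous gauss :=
  continuous_iff_continuousAt.2 fun x => (hasFDerivAt_gauss x).continuousAt

/-- The witness `v(t, x) = ramp(t) e^{-(x₀²+x₁²)} e₂` (a vertical Gaussian column switched on between
`t = -2` and `t = -1`). -/
def witness (t : ℝ) (x : EuclideanSpace ℝ (Fin 3)) : EuclideanSpace ℝ (Fin 3) :=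
  (ramp t * gauss x) • EuclideanSpace.single 2 (1 : ℝ)

/-- The slice derivative of the witness. -/
def witnessDeriv (t : ℝ) (x : EuclideanSpace ℝ (Fin 3)) :
    EuclideanSpace ℝ (Fin 3) →L[ℝ] EuclideanSpace ℝ (Fin 3) :=
  (ramp t • ((-gauss x) • rsqDeriv x)).smulRight (EuclideanSpace.single 2 (1 : ℝ))

/-- The slice `witness t` is differentiable with derivative `witnessDeriv t x`. -/
theorem hasFDerivAt_witness (t : ℝ) (x : EuclideanSpace ℝ (Fin 3)) :
    HasFDerivAt (witness t) (witnessDeriv t x) x :=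
  ((hasFDerivAt_gauss x).const_mul (ramp t)).smul_const (EuclideanSpace.single 2 (1 : ℝ))

/-- Components of `witnessDeriv t x h`: only the vertical one is non-zero. -/
@[simp]
theorem witnessDeriv_apply (t : ℝ) (x h : EuclideanSpace ℝ (Fin 3)) (i : Fin 3) :
    witnessDeriv t x h i =
      ramp t * (-gauss x * (2 * x 0 * h 0 + 2 * x 1 * h 1)) * (EuclideanSpace.single (2 : Fin 3) (1 : ℝ) i) := by
  simp [witnessDeriv, mul_assoc]
  split_ifs <;> simp

/-- `curl v(t) (x) = 2 ramp(t) e^{-(x₀²+x₁²)} (−x₁, x₀, 0)`. -/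
theorem curl_witness (t : ℝ) (x : EuclideanSpace ℝ (Fin 3)) :
    curl (witness t) x =
      (2 * ramp t * gauss x) • (-(x 1) • EuclideanSpace.single 0 (1 : ℝ) + x 0 • EuclideanSpace.single 1 (1 : ℝ)) := by
  rw [curl, (hasFDerivAt_witness t x).fderiv]
  ext i
  fin_cases i <;> simp <;> ring

/-- The slices `t ≤ -2` are irrotational (they vanish). -/
theorem curl_witness_of_le {t : ℝ} (ht : t ≤ -2) (x : EuclideanSpace ℝ (Fin 3)) : curl (witness t) x = 0 := by
  rw [curl_witness, ramp_of_le ht]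
  simp

/-- `‖witness t x‖ ≤ 1`. -/
theorem norm_witness_le (t : ℝ) (x : EuclideanSpace ℝ (Fin 3)) : ‖witness t x‖ ≤ 1 := by
  rw [witness, norm_smul, PiLp.norm_single, norm_one, mul_one, Real.norm_eq_abs,
    abs_of_nonneg (mul_nonneg (ramp_nonneg t) (gauss_pos x).le)]
  exact mul_le_one₀ (ramp_le_one t) (gauss_pos x).le (gauss_le_one x)

/-- The witness has Type-I time decay with constant `2` (it vanishes for `t ≤ -2` and is bounded by
`1 ≤ 2/√(-t)` on `-2 < t < 0`). -/
theorem witness_typeI : HasTypeITimeDecay 2 witness := by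
  intro t ht x
  by_cases h : t ≤ -2
  · have : witness t x = 0 := by simp [witness, ramp_of_le h]
    rw [this, norm_zero]
    positivity
  · push Not at h
    have hs : Real.sqrt (-t) ≤ 2 := by
      rw [show (2 : ℝ) = Real.sqrt 4 by rw [show (4 : ℝ) = 2 ^ 2 by norm_num, Real.sqrt_sq (by norm_num)]]
      exact Real.sqrt_le_sqrt (by linarith)
    have hpos : 0 < Real.sqrt (-t) := Real.sqrt_pos.2 (by linarith)
    calc ‖witness t x‖ ≤ 1 := norm_witness_le t x
      _ ≤ 2 / Real.sqrt (-t) := by rw [le_div_iff₀ hpos]; linarith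

/-- The witness is jointly continuous in `(t, x)`. -/
theorem continuous_witness : Continuous (uncurry witness) :=
  ((continuous_ramp.comp continuous_fst).mul (continuous_gauss.comp continuous_snd)).smul continuous_const

/-- Every slice of the witness is divergence free (`∂₂` of a function of `x₀, x₁` vanishes). -/
theorem witness_divFree (t : ℝ) : VectorCalculus.IsDivFree (witness t) := by
  intro x
  rw [divergence_eq_sum_inner_fderiv (EuclideanSpace.basisFun (Fin 3) ℝ), (hasFDerivAt_witness t x).fderiv]
  simp [PiLp.inner_apply]

/-- Every slice of the witness is e₃-poloidal: `⟪curl v, e₂⟫ = ∂₀v₁ − ∂₁v₀ = 0`. -/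
theorem witness_poloidal (s : ℝ) (y : EuclideanSpace ℝ (Fin 3)) :
    ⟪curl (witness s) y, EuclideanSpace.single 2 1⟫_ℝ = 0 := by
  rw [curl_witness, EuclideanSpace.inner_single_right]
  simp

/-! ### The unit circle is a closed vortex line of the slice `t = -1` -/

/-- Angular frequency of the unit-circle vortex line at `t = -1`: `Ω = 2/e`. -/
def angFreq : ℝ := 2 * Real.exp (-1)

/-- `0 < Ω`. -/
theorem angFreq_pos : 0 < angFreq := mul_pos two_pos (Real.exp_pos _)

/-- The unit circle traversed at angular frequency `Ω`. -/
def loop (s : ℝ) : EuclideanSpace ℝ (Fin 3) :=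
  Real.cos (angFreq * s) • EuclideanSpace.single 0 (1 : ℝ) + Real.sin (angFreq * s) • EuclideanSpace.single 1 (1 : ℝ)

/-- `(loop s)₀ = cos (Ω s)`. -/
@[simp] theorem loop_apply_zero (s : ℝ) : loop s 0 = Real.cos (angFreq * s) := by simp [loop]
/-- `(loop s)₁ = sin (Ω s)`. -/
@[simp] theorem loop_apply_one (s : ℝ) : loop s 1 = Real.sin (angFreq * s) := by simp [loop]
/-- `(loop s)₂ = 0`. -/
@[simp] theorem loop_apply_two (s : ℝ) : loop s 2 = 0 := by simp [loop]

/-- On the unit circle the Gaussian equals `e^{-1}`. -/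
theorem gauss_loop (s : ℝ) : gauss (loop s) = Real.exp (-1) := by
  rw [gauss, rsq, loop_apply_zero, loop_apply_one]
  congr 2
  nlinarith [Real.cos_sq_add_sin_sq (angFreq * s)]

/-- The vorticity of the slice `t = -1` along the unit circle: `Ω (−sin Ωs, cos Ωs, 0)`. -/
theorem curl_witness_loop (s : ℝ) :
    curl (witness (-1)) (loop s) =
      (-(Real.sin (angFreq * s)) * angFreq) • EuclideanSpace.single 0 (1 : ℝ) + (Real.cos (angFreq * s) * angFreq) • EuclideanSpace.single 1 (1 : ℝ) := by
  rw [curl_witness, ramp_neg_one, gauss_loop, loop_apply_zero, loop_apply_one]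
  ext i
  fin_cases i <;> simp [angFreq] <;> ring

/-- `loop` is an integral curve of `curl (witness (-1))` (a closed vortex line of the slice `t = -1`). -/
theorem hasDerivAt_loop (s : ℝ) : HasDerivAt loop (curl (witness (-1)) (loop s)) s := by
  rw [curl_witness_loop]
  have hΩ : HasDerivAt (fun r : ℝ => angFreq * r) angFreq s := by
    simpa using (hasDerivAt_id s).const_mul angFreq
  have h1 : HasDerivAt (fun r : ℝ => Real.cos (angFreq * r)) (-(Real.sin (angFreq * s)) * angFreq) s :=
    (Real.hasDerivAt_cos (angFreq * s)).comp s hΩ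
  have h2 : HasDerivAt (fun r : ℝ => Real.sin (angFreq * r)) (Real.cos (angFreq * s) * angFreq) s :=
    (Real.hasDerivAt_sin (angFreq * s)).comp s hΩ
  exact (h1.smul_const _).add (h2.smul_const _)

/-- `loop` has period `2π/Ω`. -/
theorem loop_periodic : Periodic loop (2 * Real.pi / angFreq) := by
  intro s
  have h : angFreq * (s + 2 * Real.pi / angFreq) = angFreq * s + 2 * Real.pi := by
    field_simp [angFreq_pos.ne']
  simp only [loop, h, Real.cos_add_two_pi, Real.sin_add_two_pi]

/-- The vortex line `loop` is non-stationary: the vorticity at `loop 0 = e₀` is `Ω e₁ ≠ 0`. -/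
theorem curl_witness_loop_zero_ne : curl (witness (-1)) (loop 0) ≠ 0 := by
  rw [curl_witness_loop]
  intro h
  have := congrArg (fun w : EuclideanSpace ℝ (Fin 3) => w 1) h
  simp [angFreq_pos.ne'] at this

/-! ### Load-bearing: the mild (Oseen–Duhamel) binder -/

/-- **The Oseen–Duhamel binder of `FrequencyGrowthExponent` is load-bearing**: with the NS coupling between the
slices removed the statement is false — the Gaussian column `witness` is Type-I (constant `2`), jointly
continuous, divergence-free and e₃-poloidal, its slice `t = -1` carries the non-stationary closed vortex line
`loop` (period `2π/Ω`), and its slice `t₀ = -2` has no vorticity at all. -/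
theorem frequencyGrowthExponent_false_without_mild : ¬ FrequencyGrowthExponentWithoutMild := by
  intro h
  obtain ⟨A, κ, -, -, H⟩ := h 2 witness witness_typeI continuous_witness.continuousOn
    (fun t _ => witness_divFree t) (fun s _ y => witness_poloidal s y)
  obtain ⟨c₀, T₀, -, -, -, ⟨s, hs⟩, -⟩ := H (-2) (-1) (by norm_num) (by norm_num) loop (2 * Real.pi / angFreq)
    (div_pos Real.two_pi_pos angFreq_pos) loop_periodic hasDerivAt_loop ⟨0, curl_witness_loop_zero_ne⟩
  exact hs (curl_witness_of_le le_rfl (c₀ s))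

/-! ### Load-bearing: the non-stationarity clause of the hypothesis loop -/

/-- **The non-stationarity clause of the hypothesis loop is load-bearing**: without it the zero profile (a member
of the class) refutes the statement — its constant curves are stationary closed vortex lines of every period,
while the conclusion asks for a NON-stationary loop of the zero slice. -/
theorem frequencyGrowthExponent_false_without_nonstationary : ¬ FrequencyGrowthExponentWithoutNonstationary := by
  intro h
  have hTI : HasTypeITimeDecay 1 (fun (_ : ℝ) (_ : EuclideanSpace ℝ (Fin 3)) => (0 : EuclideanSpace ℝ (Fin 3))) :=
    fun t ht x => by rw [norm_zero]; positivity
  have hmild : ∀ s t : ℝ, s < t → t < 0 → ∀ x : EuclideanSpace ℝ (Fin 3),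
      (fun (_ : ℝ) (_ : EuclideanSpace ℝ (Fin 3)) => (0 : EuclideanSpace ℝ (Fin 3))) t x =
        Literature.Analysis.UnboundedOperators.heatExtension
            ((fun (_ : ℝ) (_ : EuclideanSpace ℝ (Fin 3)) => (0 : EuclideanSpace ℝ (Fin 3))) s) (t - s) x -
          oseenDuhamel 1 s (fun (_ : ℝ) (_ : EuclideanSpace ℝ (Fin 3)) => (0 : EuclideanSpace ℝ (Fin 3)))
            (fun (_ : ℝ) (_ : EuclideanSpace ℝ (Fin 3)) => (0 : EuclideanSpace ℝ (Fin 3))) t x := by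
    intro s t _ _ x
    have h0 : (fun (_ : ℝ) (_ : EuclideanSpace ℝ (Fin 3)) => (0 : EuclideanSpace ℝ (Fin 3))) = 0 := rfl
    rw [Literature.Analysis.UnboundedOperators.heatExtension_zero_fun, h0, oseenDuhamel_zero_left]
    simp
  obtain ⟨A, κ, -, -, H⟩ := h 1 _ hTI continuous_const.continuousOn hmild
    (fun t _ x => by simp [VectorCalculus.divergence])
    (fun s _ y => by rw [curl_fun_zero, inner_zero_left])
  obtain ⟨c₀, T₀, -, -, -, ⟨s, hs⟩, -⟩ := H (-1) (-1) le_rfl (by norm_num) (fun _ => 0) 1 one_pos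
    (fun _ => rfl) (fun s => by rw [curl_fun_zero]; exact hasDerivAt_const s 0)
  exact hs (curl_fun_zero _)

end Summit.NavierStokesRegularity.NavierStokesRegularity.Theorems.FrequencyGrowthExponent.Negative

end
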